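import Summits.AtomisticToContinuum.Crystallization.Theorems.FreeSplittingCertificatesStrictSplittingRuleGroundStateHardy

/-!
# `StrictSplittingRule` (stmt-AtomisticToContinuum-12560): discrete Hardy inequalities on a path (dyadic bookkeeping of the far lemma)

Route `FreeSplittingCertificates`, crux r3 `StrictSplittingRule`, line `registered` (unit b2b-freesplit-B, gen 6).
The KORN half of the far lemma of the H12⋆ architecture (HOME CERT.md §14 (3), §15; FAR-LEMMA-SPEC §5 (c)) controls the
rotation part of the co-rotated field shell by shell: on dyadic shells `A_k = {2ᵏL < ‖y‖ ≤ 2ᵏ⁺¹L}` the mean rotations `Ω̄_k`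
satisfy `|Ω̄_{k+1} − Ω̄_k|² ≤ C·2^{−3k}·(strain energy near A_k)`, `Ω̄_0 = 0` (pinned at the reference site), while the readout
demand of the rotation part is `~ Σ_k 2^{−3k}|Ω̄_k|²`.  Charging partial sums to increments with GEOMETRIC weights is a
one-dimensional discrete Hardy inequality; this file derives it from the ground-state brick
`…GroundStateHardy.groundState_edge_le` on the path graph (vertices `0, 1, …, N`, edges `(k, k+1)`):

* `pathHardy_of_supersolution` — for edge weights `c_k ≥ 0`, a positive profile `φ` and a sequence `S` with `S 0 = 0`:
  `Σ_{k<N} w_{k+1} S_{k+1}² ≤ Σ_{k<N} c_k (S_{k+1} − S_k)²` whenever `w_{k+1} φ_{k+1} ≤ [c_{k+1}(φ_{k+1} − φ_{k+2})] + c_k(φ_{k+1} − φ_k)`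
  for `k < N` (the bracket present only for interior vertices, `k + 1 < N`);
* `pathHardy_geometric` — with `c_k = c ρᵏ` and `φ_k = θᵏ`, `c ≥ 0`, `0 < ρ`, `1 < θ`, `ρθ ≤ 1`:
  `c (θ − 1)(1 − ρθ)/θ · Σ_{k<N} ρᵏ S_{k+1}² ≤ Σ_{k<N} c ρᵏ (S_{k+1} − S_k)²`
  (for `ρ = 1/8`, `θ = √8` the constant is `(√8 − 1)²/√8 ≈ 1.18` per unit `c ρᵏ`, i.e. `Σ 8^{−k} S_{k+1}² ≤ 0.85·Σ 8^{−k}(ΔS)²`);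
* `pathHardy_geometric_vec` — the same for `ℝ³`-valued sequences (the rotation vectors `Ω̄_k`).

Structural bookkeeping ([folklore]); VALUE = a kernel-checked brick — NOT summit progress.
-/

namespace Summit.AtomisticToContinuum.Crystallization.Theorems.StrictSplittingRuleBirth

open scoped BigOperators

/-- **Discrete Hardy on a path from a supersolution.**  Edges `(k, k+1)`, `k < N`, with weights `c k ≥ 0`; a positive profile
`φ`; a sequence `S` with `S 0 = 0`.  If at every vertex `k + 1` (`k < N`)
`w (k+1) φ (k+1) ≤ [k+1 < N]·c (k+1) (φ (k+1) − φ (k+2)) + c k (φ (k+1) − φ k)`, then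
`Σ_{k<N} w (k+1) S (k+1)² ≤ Σ_{k<N} c k (S (k+1) − S k)²`. [folklore] -/
theorem pathHardy_of_supersolution (N : ℕ) (c φ w S : ℕ → ℝ) (hc : ∀ k, 0 ≤ c k) (hφ : ∀ k, 0 < φ k) (hS0 : S 0 = 0)
    (hsuper : ∀ k, k < N → w (k + 1) * φ (k + 1) ≤
      (if k + 1 < N then c (k + 1) * (φ (k + 1) - φ (k + 2)) else 0) + c k * (φ (k + 1) - φ k)) :
    ∑ k ∈ Finset.range N, w (k + 1) * S (k + 1) ^ 2 ≤ ∑ k ∈ Finset.range N, c k * (S (k + 1) - S k) ^ 2 := by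
  -- per-edge ground state: c_k (S_{k+1} − S_k)² ≥ A_k − B_k
  have hedge : ∀ k, S k ^ 2 / φ k * (c k * (φ k - φ (k + 1))) - S (k + 1) ^ 2 / φ (k + 1) * (c k * (φ k - φ (k + 1))) ≤
      c k * (S (k + 1) - S k) ^ 2 := fun k => by
    have e : (S (k + 1) - S k) ^ 2 = (S k - S (k + 1)) ^ 2 := by ring
    have e2 : S k ^ 2 / φ k * (c k * (φ k - φ (k + 1))) - S (k + 1) ^ 2 / φ (k + 1) * (c k * (φ k - φ (k + 1))) =
        c k * (φ k - φ (k + 1)) * (S k ^ 2 / φ k - S (k + 1) ^ 2 / φ (k + 1)) := by ring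
    rw [e, e2]
    exact groundState_edge_le (hc k) (hφ k).le (hφ (k + 1)).le (fun _ => hφ k) (fun _ => hφ (k + 1))
  refine le_trans ?_ (Finset.sum_le_sum fun k _ => hedge k)
  rw [Finset.sum_sub_distrib]
  -- shift the A-part: Σ_{k<N} A_k = A_0 + Σ_{k<N} [k+1 < N]·A_{k+1}, and A_0 = 0
  cases N with
  | zero => simp
  | succ n =>
    have hA : ∑ k ∈ Finset.range (n + 1), S k ^ 2 / φ k * (c k * (φ k - φ (k + 1))) =
        ∑ k ∈ Finset.range (n + 1),
          (if k + 1 < n + 1 then S (k + 1) ^ 2 / φ (k + 1) * (c (k + 1) * (φ (k + 1) - φ (k + 2))) else 0) := by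
      rw [Finset.sum_range_succ' (fun k => S k ^ 2 / φ k * (c k * (φ k - φ (k + 1)))), hS0]
      simp only [zero_pow two_ne_zero, zero_div, zero_mul, add_zero]
      rw [Finset.sum_range_succ (fun k => if k + 1 < n + 1 then _ else _)]
      simp only [lt_irrefl, if_false, add_zero]
      refine Finset.sum_congr rfl fun k hk => ?_
      rw [if_pos (by simpa using Finset.mem_range.1 hk)]
    rw [hA, ← Finset.sum_sub_distrib]
    refine Finset.sum_le_sum fun k hk => ?_
    have hkN : k < n + 1 := Finset.mem_range.1 hk
    have hφk := hφ (k + 1)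
    have hq : 0 ≤ S (k + 1) ^ 2 / φ (k + 1) := by positivity
    have key := hsuper k hkN
    have e : (if k + 1 < n + 1 then S (k + 1) ^ 2 / φ (k + 1) * (c (k + 1) * (φ (k + 1) - φ (k + 2))) else 0) -
        S (k + 1) ^ 2 / φ (k + 1) * (c k * (φ k - φ (k + 1))) =
        S (k + 1) ^ 2 / φ (k + 1) *
          ((if k + 1 < n + 1 then c (k + 1) * (φ (k + 1) - φ (k + 2)) else 0) + c k * (φ (k + 1) - φ k)) := by
      split_ifs <;> ring
    rw [e]
    calc w (k + 1) * S (k + 1) ^ 2 = S (k + 1) ^ 2 / φ (k + 1) * (w (k + 1) * φ (k + 1)) := by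
          field_simp [hφk.ne']
      _ ≤ _ := mul_le_mul_of_nonneg_left key hq

/-- **Geometric weights.**  For `c ≥ 0`, `0 < ρ`, `1 < θ` and `S 0 = 0`:
`c (θ − 1)(1 − ρθ)/θ · Σ_{k<N} ρᵏ S_{k+1}² ≤ Σ_{k<N} c ρᵏ (S_{k+1} − S_k)²` (profile `φ_k = θᵏ`; the constant is positive iff
`ρθ < 1`, and is maximised at `θ = ρ^{−1/2}`, where it equals `c (1 − √ρ)²/√ρ`). [folklore] -/
theorem pathHardy_geometric (N : ℕ) {c ρ θ : ℝ} (hc : 0 ≤ c) (hρ : 0 < ρ) (hθ : 1 < θ) (S : ℕ → ℝ)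
    (hS0 : S 0 = 0) :
    c * (θ - 1) * (1 - ρ * θ) / θ * ∑ k ∈ Finset.range N, ρ ^ k * S (k + 1) ^ 2 ≤
      ∑ k ∈ Finset.range N, c * ρ ^ k * (S (k + 1) - S k) ^ 2 := by
  have hθ0 : 0 < θ := lt_trans one_pos hθ
  rw [Finset.mul_sum]
  have e : ∀ k ∈ Finset.range N, c * (θ - 1) * (1 - ρ * θ) / θ * (ρ ^ k * S (k + 1) ^ 2) =
      (c * (θ - 1) * (1 - ρ * θ) / θ * ρ ^ k) * S (k + 1) ^ 2 := fun k _ => by ring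
  rw [Finset.sum_congr rfl e]
  refine pathHardy_of_supersolution N (fun k => c * ρ ^ k) (fun k => θ ^ k)
    (fun k => c * (θ - 1) * (1 - ρ * θ) / θ * ρ ^ (k - 1)) S (fun k => by positivity) (fun k => by positivity) hS0 ?_
  intro k hk
  simp only [Nat.add_sub_cancel]
  -- w_{k+1} φ_{k+1} = c (θ−1)(1−ρθ) ρ^k θ^k; the supersolution value is c ρ^k θ^k (θ−1)(1 − ρθ) + [interior] extra ≥ 0
  have hout : c * (θ - 1) * (1 - ρ * θ) / θ * ρ ^ k * θ ^ (k + 1) ≤ c * ρ ^ k * (θ ^ (k + 1) - θ ^ k) := by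
    have h1 : c * (θ - 1) * (1 - ρ * θ) / θ * ρ ^ k * θ ^ (k + 1) = c * ρ ^ k * θ ^ k * (θ - 1) * (1 - ρ * θ) := by
      rw [pow_succ]; field_simp
    have h2 : c * ρ ^ k * (θ ^ (k + 1) - θ ^ k) = c * ρ ^ k * θ ^ k * (θ - 1) := by rw [pow_succ]; ring
    rw [h1, h2]
    have hA : 0 ≤ c * ρ ^ k * θ ^ k * (θ - 1) := by
      have := mul_nonneg (mul_nonneg hc (pow_nonneg hρ.le k)) (pow_nonneg hθ0.le k)
      exact mul_nonneg this (by linarith)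
    have hρθ0 : 0 ≤ ρ * θ := by positivity
    nlinarith
  have hin : 0 ≤ (if k + 1 < N then c * ρ ^ (k + 1) * (θ ^ (k + 1) - θ ^ (k + 2)) else 0) +
      (c * ρ ^ k * (θ ^ (k + 1) - θ ^ k) - c * (θ - 1) * (1 - ρ * θ) / θ * ρ ^ k * θ ^ (k + 1)) := by
    split_ifs with hlt
    · -- interior: c ρ^k θ^k [ (θ−1) − (θ−1)(1−ρθ) − ρθ(θ−1) ] = 0
      have e3 : c * ρ ^ (k + 1) * (θ ^ (k + 1) - θ ^ (k + 2)) +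
          (c * ρ ^ k * (θ ^ (k + 1) - θ ^ k) - c * (θ - 1) * (1 - ρ * θ) / θ * ρ ^ k * θ ^ (k + 1)) = 0 := by
        rw [pow_succ, pow_succ, pow_succ]; field_simp; ring
      rw [e3]
    · linarith
  linarith

/-- **Geometric weights, vector version** (`ℝ³`-valued sequences, coordinatewise). [folklore] -/
theorem pathHardy_geometric_vec (N : ℕ) {c ρ θ : ℝ} (hc : 0 ≤ c) (hρ : 0 < ρ) (hθ : 1 < θ)
    (S : ℕ → EuclideanSpace ℝ (Fin 3)) (hS0 : S 0 = 0) :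
    c * (θ - 1) * (1 - ρ * θ) / θ * ∑ k ∈ Finset.range N, ρ ^ k * ‖S (k + 1)‖ ^ 2 ≤
      ∑ k ∈ Finset.range N, c * ρ ^ k * ‖S (k + 1) - S k‖ ^ 2 := by
  have hn : ∀ z : EuclideanSpace ℝ (Fin 3), ‖z‖ ^ 2 = ∑ i, z i ^ 2 := fun z => by
    rw [EuclideanSpace.norm_eq, Real.sq_sqrt (Finset.sum_nonneg fun i _ => sq_nonneg _)]
    exact Finset.sum_congr rfl fun i _ => by rw [Real.norm_eq_abs, sq_abs]
  have hsc : ∀ i, c * (θ - 1) * (1 - ρ * θ) / θ * ∑ k ∈ Finset.range N, ρ ^ k * (S (k + 1) i) ^ 2 ≤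
      ∑ k ∈ Finset.range N, c * ρ ^ k * (S (k + 1) i - S k i) ^ 2 := fun i =>
    pathHardy_geometric N hc hρ hθ (fun k => S k i) (by rw [hS0]; rfl)
  calc c * (θ - 1) * (1 - ρ * θ) / θ * ∑ k ∈ Finset.range N, ρ ^ k * ‖S (k + 1)‖ ^ 2
      = ∑ i, c * (θ - 1) * (1 - ρ * θ) / θ * ∑ k ∈ Finset.range N, ρ ^ k * (S (k + 1) i) ^ 2 := by
        rw [← Finset.mul_sum, Finset.sum_comm]
        congr 1
        exact Finset.sum_congr rfl fun k _ => by rw [hn (S (k + 1)), Finset.mul_sum]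
    _ ≤ ∑ i, ∑ k ∈ Finset.range N, c * ρ ^ k * (S (k + 1) i - S k i) ^ 2 := Finset.sum_le_sum fun i _ => hsc i
    _ = ∑ k ∈ Finset.range N, c * ρ ^ k * ‖S (k + 1) - S k‖ ^ 2 := by
        rw [Finset.sum_comm]
        refine Finset.sum_congr rfl fun k _ => ?_
        rw [hn (S (k + 1) - S k), Finset.mul_sum]
        exact Finset.sum_congr rfl fun i _ => by rw [PiLp.sub_apply]

end Summit.AtomisticToContinuum.Crystallization.Theorems.StrictSplittingRuleBirth
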